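import Summits.RiemannHypothesis.RiemannHypothesis.Theorems.HandoffLadderRungOne
import Summits.RiemannHypothesis.RiemannHypothesis.Theorems.HandoffDodgerUpperClause
import Summits.RiemannHypothesis.RiemannHypothesis.Theorems.SemilocalTwoThreeLowerLog5Half
import Summits.RiemannHypothesis.RiemannHypothesis.Theorems.SemilocalNegCertThirteen
import Summits.RiemannHypothesis.RiemannHypothesis.Theorems.SemilocalNegCertSeventeen
import Summits.RiemannHypothesis.RiemannHypothesis.Theorems.SemilocalNegCertNineteen
import Summits.RiemannHypothesis.RiemannHypothesis.Theorems.SemilocalNegCertTwentyThreeLight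
import Summits.RiemannHypothesis.RiemannHypothesis.Theorems.SemilocalNegCertTwentyNineLight
import Summits.RiemannHypothesis.RiemannHypothesis.Theorems.SemilocalNegCertUptoThirtyOne
import Summits.RiemannHypothesis.RiemannHypothesis.Theorems.SemilocalNegCertUptoThirtySeven
import Summits.RiemannHypothesis.RiemannHypothesis.Theorems.SemilocalNegCertUptoFortyOne
import Summits.RiemannHypothesis.RiemannHypothesis.Theorems.SemilocalNegCertUptoFortyThree
import Summits.RiemannHypothesis.RiemannHypothesis.Theorems.SemilocalNegCertUptoFortySeven
import Summits.RiemannHypothesis.RiemannHypothesis.Theorems.SemilocalNegCertUptoFiftyThree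
import Summits.RiemannHypothesis.RiemannHypothesis.Theorems.SemilocalNegCertUptoFiftyNine
import Summits.RiemannHypothesis.RiemannHypothesis.Theorems.SemilocalNegCertUptoSixtyOneFinal
import Summits.RiemannHypothesis.RiemannHypothesis.Theorems.SemilocalNegCertUptoSixtySeven
import Summits.RiemannHypothesis.RiemannHypothesis.Theorems.SemilocalNegCertUptoSeventyOne
import Summits.RiemannHypothesis.RiemannHypothesis.Theorems.SemilocalNegCertUptoSeventyThree
import HarnessLib

/-!
# C-I(a) — the SEMILOCAL CLASS / LOCALITY LAW, typed, and PROVED for every finite `S` whose least missing prime is `≤ 79` (RH-FREE)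

RH-FREE (LADDER-RH column WEIL, rung PROOF-OF-DATA, target (P2); cell `rh-explicit`, HUMAN RULING D-0040; typing lane cc-s2-1, pen cc-s2-3 whose
draft `HOME/cc-s2-3/gen10/lean/SemilocalClassLaw.lean` this file supersedes).  HONEST FRAMING: every statement is about the tree's semi-local
thresholds `a*(S) = weilSemilocalThreshold S` of TRUNCATED Weil forms (finitely many places); nothing here bears on the truth of RH and no
statement speaks of zeros.  The LOWER clause `(log q)/2 ≤ a*(S)` at ALL primes IS RH (`riemannHypothesis_iff_forall_log_half_le_weilSemilocalThreshold`);
it enters only for `q ≤ 7`, where it is a THEOREM (the `a = 1` rung), and as an explicitly RH-conditional corollary.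

THE LAW (HOME/STRUCTURE.md §2 C-I(a)): «for every finite `S` with `{p < q} ⊆ S ∌ q` (`q` = the least prime missing from `S`):
`(log q)/2 < a*(S) < (log q⁺)/2`, `q⁺ = nextPrime q` — the threshold CLASS of `S` is EXACTLY its least missing prime.»  RH-free content =
the UPPER clause `UC(q) : a*(S_q) < (log q⁺)/2`, `S_q = Nat.primesBelow q` (one negativity certificate per prime) + FIRST-GAP LOCALITY
(theory-1's `HandoffDecomposition.weilSemilocalThreshold_eq_of_firstGap`: `UC(q) ⇒ a*(S) = a*(S_q)` on the class of `q`).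

CONTENTS (all PROVED, standard axioms): §1 the parametrised predicates (cell rule R13-0) `SemilocalClassLawAt q` (the pen's sentence
`∀ q' prime > q, a*(S_q) < (log q')/2`), `SemilocalClassLawBelow Q`, `SemilocalClassLawFrom q₀` and the dictionary
`SemilocalClassLawAt q ↔ UC(q) ↔ ¬(S_q-positivity on C((log q⁺)/2)) ↔ 0 < r(q) ↔ δ*(q) < (log q⁺ − log q)/2`; §2 `leastMissingPrime S` and the
CLASS THEOREM for every finite `S`; §3 INSTANCES `SemilocalClassLawAt q` for EVERY prime `q ≤ 79` (22 walls) from the tree's kernel wall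
certificates (cc-s2-4 `SemilocalNegCert*`; `q ≤ 13` via theory-2's `HandoffUpperClauses`) ⇒ `semilocalClassLawBelow_eighty`; §4 for EVERY finite
`S` with `leastMissingPrime S ≤ 79`: `a*(S) = a*(S_q) < (log q⁺)/2` UNCONDITIONALLY, the two-sided class `(log q)/2 ≤ a*(S) < (log q⁺)/2`
unconditionally for `q ≤ 7` and under RH in general (and it PINS `q`), `1 ≤ a*(S)` for `q ≥ 11`; §5 the TAIL: `C-I(a) ⟺ SemilocalClassLawFrom 80`,
and prove-2's exponent-3/2 wall ceiling ⇒ `SemilocalClassLawFrom q₁` (the column's targets (P1)/(P2) meet here).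
EVIDENCE for the open tail (DATA, unused): certified two-engine walls `q ≤ 73`, kernel rows to `q = 157` queued (SEMILOCAL-TABLE §5–§7).
References: H. Yoshida, Adv. Stud. Pure Math. 21 (1992) Prop. 6 p. 320 (`Yoshida1992HermitianForms`); A. Connes, C. Consani, Enseign. Math. 69
(2023) §2.1.2 (`ConnesConsani2023`); E. Bombieri, Rend. Mat. Acc. Lincei (9) 11 (2000) §4 (`Bombieri2000Weil`).  The class-law sentences are, as far
as searched (SEMILOCAL-TABLE.md §5, STRUCTURE.md §2, LADDER-R3.md), not in print: theorems about the tree's object.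
-/

set_option linter.dupNamespace false  -- the mandated namespace repeats `RiemannHypothesis`
noncomputable section
open Set Literature.NumberTheory.LFunctions
open Summit.RiemannHypothesis.RiemannHypothesis.Theorems
open Summit.RiemannHypothesis.RiemannHypothesis.Theorems.Handoff (ConsecutivePrimes upperClause_eventually_of_dodgerWallCeiling)
open Summit.RiemannHypothesis.RiemannHypothesis.Theorems.HandoffDecomposition
open Summit.RiemannHypothesis.RiemannHypothesis.Theorems.HandoffLoadCeiling (handoffLoad_pos_iff)
open Summit.RiemannHypothesis.RiemannHypothesis.Theorems.HandoffSemilocalEnergy (handoffLoad)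
open Summit.RiemannHypothesis.RiemannHypothesis.Theorems.HandoffMarginLaw (wallOffset)
open Summit.RiemannHypothesis.RiemannHypothesis.Theorems.HandoffUpperClauses
open Summit.RiemannHypothesis.RiemannHypothesis.Theorems.MotivicDoor.SemilocalThreshold
open Summit.RiemannHypothesis.RiemannHypothesis.Theorems.MotivicDoor.Semilocal (weilSemilocalPositivityOn_iff_weilPositivityOn_of_le)
open Summit.RiemannHypothesis.RiemannHypothesis.Theorems.SemilocalPolyWitness

namespace Summit.RiemannHypothesis.RiemannHypothesis.Theorems.SemilocalClassLaw

variable {q Q q₀ : ℕ} {S : Finset ℕ}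

/-! ## §1  The parametrised predicates and their dictionary -/

/-- **C-I(a) at `q`** (the pen's sentence, cc-s2-3): the threshold of the form keeping exactly the primes `< q` lies below EVERY
later prime's coincidence point `(log q')/2`. RH-free; one negativity certificate per `q`. [this cell, HOME/STRUCTURE.md §2 C-I(a); thresholds as in Yoshida 1992 Prop. 6 with the primes restricted to `S`] -/
def SemilocalClassLawAt (q : ℕ) : Prop :=
  ∀ q' : ℕ, q'.Prime → q < q' → weilSemilocalThreshold (Nat.primesBelow q) < Real.log q' / 2

/-- **C-I(a) below `Q`**: the law at every prime `q < Q` (the PROVED initial segment is stated in this currency). [this cell, HOME/STRUCTURE.md §2 C-I(a)] -/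
def SemilocalClassLawBelow (Q : ℕ) : Prop :=
  ∀ q : ℕ, q.Prime → q < Q → SemilocalClassLawAt q

/-- **C-I(a) from `q₀` on** (the TAIL; `SemilocalClassLawFrom 0` is the whole conjecture C-I(a)). [this cell, HOME/STRUCTURE.md §2 C-I(a)] -/
def SemilocalClassLawFrom (q₀ : ℕ) : Prop :=
  ∀ q : ℕ, q.Prime → q₀ ≤ q → SemilocalClassLawAt q

/-- `SemilocalClassLawAt q` is the tree's UPPER CLAUSE `UC(q) : a*(S_q) < (log q⁺)/2`. [folklore] -/
theorem semilocalClassLawAt_iff_upperClause :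
    SemilocalClassLawAt q ↔ weilSemilocalThreshold (Nat.primesBelow q) < Real.log (nextPrime q) / 2 := by
  refine ⟨fun h ↦ h _ (nextPrime_prime q) (lt_nextPrime q), fun h q' hq' hqq' ↦ lt_of_lt_of_le h ?_⟩
  have h1 : (nextPrime q : ℝ) ≤ q' := by exact_mod_cast nextPrime_le hq' hqq'
  have h0 : (0 : ℝ) < nextPrime q := by exact_mod_cast (nextPrime_prime q).pos
  linarith [Real.log_le_log h0 h1]

/-- A sufficient form with an explicit ceiling: no prime strictly between `q` and `Q` and `a*(S_q) < (log Q)/2`. [folklore] -/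
theorem semilocalClassLawAt_of_lt (hQ : ∀ m : ℕ, q < m → m < Q → ¬ m.Prime)
    (hlt : weilSemilocalThreshold (Nat.primesBelow q) < Real.log Q / 2) : SemilocalClassLawAt q := by
  intro q' hq' hqq'
  have hQq' : Q ≤ q' := by
    by_contra h
    exact hQ q' hqq' (not_le.1 h) hq'
  rcases Nat.eq_zero_or_pos Q with rfl | hQ0
  · simp only [Nat.cast_zero, Real.log_zero, zero_div] at hlt
    exact absurd hlt (not_lt.2 (weilSemilocalThreshold_pos _).le)
  · have h1 : (Q : ℝ) ≤ q' := by exact_mod_cast hQq'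
    have h0 : (0 : ℝ) < Q := by exact_mod_cast hQ0
    linarith [Real.log_le_log h0 h1]

/-- The same with the literal `T = S_q` read off the certificate's statement. [folklore] -/
theorem semilocalClassLawAt_of_eq {T : Finset ℕ} (hT : Nat.primesBelow q = T) (hQ : ∀ m : ℕ, q < m → m < Q → ¬ m.Prime)
    (hlt : weilSemilocalThreshold T < Real.log Q / 2) : SemilocalClassLawAt q :=
  semilocalClassLawAt_of_lt hQ (hT ▸ hlt)

/-- Dictionary 1: C-I(a) at `q` iff the OLD form `S_q` is NOT positive on the window of `q⁺` (the handoff at `q` is a genuine rescue). [folklore] -/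
theorem semilocalClassLawAt_iff_not_weilSemilocalPositivityOn :
    SemilocalClassLawAt q ↔ ¬ WeilSemilocalPositivityOn (Nat.primesBelow q) (Real.log (nextPrime q) / 2) := by
  rw [semilocalClassLawAt_iff_upperClause, not_weilSemilocalPositivityOn_iff_weilSemilocalThreshold_lt]

/-- Dictionary 2: for `q` prime, C-I(a) at `q` iff the handoff LOAD is positive, `0 < r(q)`. [this cell (HANDOFF track)] -/
theorem semilocalClassLawAt_iff_handoffLoad_pos (hq : q.Prime) :
    SemilocalClassLawAt q ↔ 0 < handoffLoad q (nextPrime q) := by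
  rw [semilocalClassLawAt_iff_upperClause, handoffLoad_pos_iff (consecutivePrimes_nextPrime hq)]

/-- Dictionary 3: C-I(a) at `q` iff the wall OFFSET is smaller than half the log-gap: `δ*(q) < (log q⁺ − log q)/2`. [this cell (A4)] -/
theorem semilocalClassLawAt_iff_wallOffset_lt :
    SemilocalClassLawAt q ↔ wallOffset q < (Real.log (nextPrime q) - Real.log q) / 2 := by
  rw [semilocalClassLawAt_iff_upperClause, wallOffset]
  constructor <;> intro h <;> linarith

/-! ## §2  The least missing prime and the CLASS THEOREM for every finite `S` -/

/-- Every finite set of naturals misses some prime. [folklore] -/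
theorem exists_prime_not_mem (S : Finset ℕ) : ∃ q : ℕ, q.Prime ∧ q ∉ S := by
  obtain ⟨q, hq, hqS, -⟩ := exists_firstGap S
  exact ⟨q, hq, hqS⟩

open Classical in
/-- **The least missing prime** `q(S)` of a finite `S ⊆ ℕ` (the cell's «class index» of `S`). [this cell, HOME/STRUCTURE.md §2 C-I(a)] -/
def leastMissingPrime (S : Finset ℕ) : ℕ := Nat.find (exists_prime_not_mem S)

open Classical in
/-- `q(S)` is prime. [folklore] -/
theorem leastMissingPrime_prime (S : Finset ℕ) : (leastMissingPrime S).Prime := (Nat.find_spec (exists_prime_not_mem S)).1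

open Classical in
/-- `q(S) ∉ S`. [folklore] -/
theorem leastMissingPrime_not_mem (S : Finset ℕ) : leastMissingPrime S ∉ S := (Nat.find_spec (exists_prime_not_mem S)).2

open Classical in
/-- Every prime below `q(S)` lies in `S`. [folklore] -/
theorem mem_of_prime_lt_leastMissingPrime {p : ℕ} (hp : p.Prime) (hlt : p < leastMissingPrime S) : p ∈ S := by
  by_contra h
  exact Nat.find_min (exists_prime_not_mem S) hlt ⟨hp, h⟩

open Classical in
/-- Characterisation: `q(S) = q` iff `q` is a prime outside `S` with all smaller primes inside. [folklore] -/
theorem leastMissingPrime_eq_iff : leastMissingPrime S = q ↔ q.Prime ∧ q ∉ S ∧ ∀ p : ℕ, p.Prime → p < q → p ∈ S := by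
  constructor
  · rintro rfl
    exact ⟨leastMissingPrime_prime S, leastMissingPrime_not_mem S, fun p hp hlt ↦ mem_of_prime_lt_leastMissingPrime hp hlt⟩
  · rintro ⟨hq, hqS, hS⟩
    refine le_antisymm (Nat.find_min' _ ⟨hq, hqS⟩) ?_
    by_contra hlt
    exact leastMissingPrime_not_mem S (hS _ (leastMissingPrime_prime S) (not_le.1 hlt))

/-- For a prime `q`, `q(S_q) = q`. [folklore] -/
theorem leastMissingPrime_primesBelow (hq : q.Prime) : leastMissingPrime (Nat.primesBelow q) = q :=
  leastMissingPrime_eq_iff.2 ⟨hq, by simp [Nat.mem_primesBelow], fun p hp hlt ↦ Nat.mem_primesBelow.2 ⟨hlt, hp⟩⟩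

/-- **THE CLASS THEOREM (RH-free, every finite `S`)**: C-I(a) at the least missing prime `q = q(S)` ⇒ `a*(S) = a*(S_q)` — first-gap locality (theory-1's `weilSemilocalThreshold_eq_of_firstGap`). [cite: ConnesConsani2023, §2.1.2 (only the primes p < λ² enter the semi-local form)] -/
theorem weilSemilocalThreshold_eq_of_classLawAt (h : SemilocalClassLawAt (leastMissingPrime S)) :
    weilSemilocalThreshold S = weilSemilocalThreshold (Nat.primesBelow (leastMissingPrime S)) :=
  weilSemilocalThreshold_eq_of_firstGap (leastMissingPrime_prime S) (fun _ hlt hp ↦ mem_of_prime_lt_leastMissingPrime hp hlt)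
    (leastMissingPrime_not_mem S) (semilocalClassLawAt_iff_upperClause.1 h)

/-- … and then `a*(S) < (log q⁺)/2`: the form of `S` dies inside the window of its least missing prime. [this cell, HOME/STRUCTURE.md §2 C-I(a)] -/
theorem weilSemilocalThreshold_lt_of_classLawAt (h : SemilocalClassLawAt (leastMissingPrime S)) :
    weilSemilocalThreshold S < Real.log (nextPrime (leastMissingPrime S)) / 2 := by
  rw [weilSemilocalThreshold_eq_of_classLawAt h]
  exact semilocalClassLawAt_iff_upperClause.1 h

/-- Membership form of the class theorem: `{p < q} ⊆ S ∌ q` with `q` prime and C-I(a) at `q` ⇒ `a*(S) = a*(S_q)`. [cite: ConnesConsani2023, §2.1.2] -/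
theorem weilSemilocalThreshold_eq_of_classLawAt' (hq : q.Prime) (hS : ∀ p : ℕ, p.Prime → p < q → p ∈ S) (hqS : q ∉ S)
    (h : SemilocalClassLawAt q) : weilSemilocalThreshold S = weilSemilocalThreshold (Nat.primesBelow q) := by
  obtain rfl : leastMissingPrime S = q := leastMissingPrime_eq_iff.2 ⟨hq, hqS, hS⟩
  exact weilSemilocalThreshold_eq_of_classLawAt h

/-- RH-conditional LOWER clause for every finite `S`: `RH → (log q(S))/2 ≤ a*(S)`. [cite: Bombieri2000Weil, §4 (Weil's criterion); Yoshida1992HermitianForms, Prop. 6] -/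
theorem log_half_le_weilSemilocalThreshold_of_riemannHypothesis (hRH : Summit.RiemannHypothesis) (S : Finset ℕ) :
    Real.log (leastMissingPrime S) / 2 ≤ weilSemilocalThreshold S := by
  have h1 := (leastMissingPrime_prime S).one_lt.le
  have h := le_weilSemilocalThreshold_of_riemannHypothesis hRH (S := S) (N := leastMissingPrime S - 1) fun n hn _ p hp ↦
    mem_of_prime_lt_leastMissingPrime (Nat.prime_of_mem_primeFactors hp) (by have := Nat.le_of_mem_primeFactors hp; omega)
  rwa [show ((leastMissingPrime S - 1 : ℕ) : ℝ) + 1 = leastMissingPrime S by exact_mod_cast Nat.sub_add_cancel h1] at h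

/-! ## §3  Instances: C-I(a) at every prime `q ≤ 79` -/

/-- `q = 2`. [tree certificate `SemilocalNegCertEmpty`; thresholds: Yoshida1992HermitianForms Prop. 6] -/
theorem semilocalClassLawAt_two : SemilocalClassLawAt 2 :=
  semilocalClassLawAt_of_lt (Q := 3) (fun m h1 h2 ↦ by omega) weilSemilocalThreshold_primesBelow_two_lt

/-- `q = 3`. [tree certificate `SemilocalNegCert05575`; thresholds: Yoshida1992HermitianForms Prop. 6] -/
theorem semilocalClassLawAt_three : SemilocalClassLawAt 3 :=
  semilocalClassLawAt_of_lt (Q := 5) (fun m h1 h2 ↦ by interval_cases m; decide) weilSemilocalThreshold_primesBelow_three_lt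

/-- `q = 5`. [tree certificate `SemilocalNegCertTwoThree`; thresholds: Yoshida1992HermitianForms Prop. 6] -/
theorem semilocalClassLawAt_five : SemilocalClassLawAt 5 :=
  semilocalClassLawAt_of_lt (Q := 7) (fun m h1 h2 ↦ by interval_cases m; decide) weilSemilocalThreshold_primesBelow_five_lt

/-- `q = 7`. [tree certificate `SemilocalNegCertTwoThreeFive`; thresholds: Yoshida1992HermitianForms Prop. 6] -/
theorem semilocalClassLawAt_seven : SemilocalClassLawAt 7 :=
  semilocalClassLawAt_of_lt (Q := 11) (fun m h1 h2 ↦ by interval_cases m <;> decide) weilSemilocalThreshold_primesBelow_seven_lt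

/-- `q = 11`. [tree certificate `SemilocalNegCertSeven`; thresholds: Yoshida1992HermitianForms Prop. 6] -/
theorem semilocalClassLawAt_eleven : SemilocalClassLawAt 11 :=
  semilocalClassLawAt_of_lt (Q := 13) (fun m h1 h2 ↦ by interval_cases m; decide) weilSemilocalThreshold_primesBelow_eleven_lt

/-- `q = 13`. [tree certificate `SemilocalNegCertEleven`; thresholds: Yoshida1992HermitianForms Prop. 6] -/
theorem semilocalClassLawAt_thirteen : SemilocalClassLawAt 13 :=
  semilocalClassLawAt_of_lt (Q := 17) (fun m h1 h2 ↦ by interval_cases m <;> decide) weilSemilocalThreshold_primesBelow_thirteen_lt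

/-- `q = 17` (`a*(S_17) ≤ 143/100 < (log 18)/2`). [tree certificate `SemilocalNegCertThirteen`; thresholds: Yoshida1992HermitianForms Prop. 6] -/
theorem semilocalClassLawAt_seventeen : SemilocalClassLawAt 17 :=
  semilocalClassLawAt_of_eq (Q := 18) (by decide) (fun m h1 h2 ↦ by omega) weilSemilocalThreshold_uptoThirteen_lt_log_eighteen_half

/-- `q = 19` (`a*(S_19) ≤ 95/64 < (log 20)/2`). [tree certificate `SemilocalNegCertSeventeen`; thresholds: Yoshida1992HermitianForms Prop. 6] -/
theorem semilocalClassLawAt_nineteen : SemilocalClassLawAt 19 :=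
  semilocalClassLawAt_of_eq (Q := 20) (by decide) (fun m h1 h2 ↦ by omega) weilSemilocalThreshold_uptoSeventeen_lt_log_twenty_half

/-- `q = 23` (`a*(S_23) ≤ 203/128 < (log 24)/2`). [tree certificate `SemilocalNegCertNineteen`; thresholds: Yoshida1992HermitianForms Prop. 6] -/
theorem semilocalClassLawAt_twentythree : SemilocalClassLawAt 23 :=
  semilocalClassLawAt_of_eq (Q := 24) (by decide) (fun m h1 h2 ↦ by omega) weilSemilocalThreshold_uptoNineteen_lt_log_twentyfour_half

/-- `q = 29` (`a*(S_29) ≤ 435/256 < (log 30)/2`). [tree certificate `SemilocalNegCertTwentyThreeLight`; thresholds: Yoshida1992HermitianForms Prop. 6] -/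
theorem semilocalClassLawAt_twentynine : SemilocalClassLawAt 29 :=
  semilocalClassLawAt_of_eq (Q := 30) (by decide) (fun m h1 h2 ↦ by omega) weilSemilocalThreshold_uptoTwentyThree_lt_log_thirty_half

/-- `q = 31` (`a*(S_31) ≤ 443/256 < (log 32)/2`). [tree certificate `SemilocalNegCertTwentyNineLight`; thresholds: Yoshida1992HermitianForms Prop. 6] -/
theorem semilocalClassLawAt_thirtyone : SemilocalClassLawAt 31 :=
  semilocalClassLawAt_of_eq (Q := 32) (by decide) (fun m h1 h2 ↦ by omega) weilSemilocalThreshold_uptoTwentyNine_lt_log_thirtytwo_half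

/-- `q = 37` (`a*(S_37) ≤ 233/128 < (log 40)/2`). [tree certificate `SemilocalNegCertUptoThirtyOne`; thresholds: Yoshida1992HermitianForms Prop. 6] -/
theorem semilocalClassLawAt_thirtyseven : SemilocalClassLawAt 37 :=
  semilocalClassLawAt_of_eq (Q := 40) (by decide) (fun m h1 h2 ↦ by interval_cases m <;> decide) weilSemilocalThreshold_uptoThirtyOne_lt_log_forty_half

/-- `q = 41` (`a*(S_41) ≤ 15/8 < (log 43)/2`). [tree certificate `SemilocalNegCertUptoThirtySeven`; thresholds: Yoshida1992HermitianForms Prop. 6] -/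
theorem semilocalClassLawAt_fortyone : SemilocalClassLawAt 41 :=
  semilocalClassLawAt_of_eq (Q := 43) (by decide) (fun m h1 h2 ↦ by interval_cases m; decide) weilSemilocalThreshold_uptoThirtySeven_lt_log_fortythree_half

/-- `q = 43` (`a*(S_43) ≤ 61/32 < (log 46)/2`). [tree certificate `SemilocalNegCertUptoFortyOne`; thresholds: Yoshida1992HermitianForms Prop. 6] -/
theorem semilocalClassLawAt_fortythree : SemilocalClassLawAt 43 :=
  semilocalClassLawAt_of_eq (Q := 46) (by decide) (fun m h1 h2 ↦ by interval_cases m <;> decide) weilSemilocalThreshold_uptoFortyOne_lt_log_fortysix_half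

/-- `q = 47` (`a*(S_47) ≤ 499/256 < (log 50)/2`). [tree certificate `SemilocalNegCertUptoFortyThree`; thresholds: Yoshida1992HermitianForms Prop. 6] -/
theorem semilocalClassLawAt_fortyseven : SemilocalClassLawAt 47 :=
  semilocalClassLawAt_of_eq (Q := 50) (by decide) (fun m h1 h2 ↦ by interval_cases m <;> decide) weilSemilocalThreshold_uptoFortyThree_lt_log_fifty_half

/-- `q = 53` (`a*(S_53) ≤ 257/128 < (log 56)/2`). [tree certificate `SemilocalNegCertUptoFortySeven`; thresholds: Yoshida1992HermitianForms Prop. 6] -/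
theorem semilocalClassLawAt_fiftythree : SemilocalClassLawAt 53 :=
  semilocalClassLawAt_of_eq (Q := 56) (by decide) (fun m h1 h2 ↦ by interval_cases m <;> decide) weilSemilocalThreshold_uptoFortySeven_lt_log_fiftysix_half

/-- `q = 59` (`a*(S_59) ≤ 263/128 < (log 61)/2`, margin `7·10⁻⁴`: the tree enclosure `logSixtyOneLo ≤ log 61`). [tree certificate `SemilocalNegCertUptoFiftyThree`; thresholds: Yoshida1992HermitianForms Prop. 6] -/
theorem semilocalClassLawAt_fiftynine : SemilocalClassLawAt 59 := by
  refine semilocalClassLawAt_of_lt (Q := 61) (fun m h1 h2 ↦ by interval_cases m; decide) ?_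
  rw [show Nat.primesBelow 59 = {2, 3, 5, 7, 11, 13, 17, 19, 23, 29, 31, 37, 41, 43, 47, 53} from by decide]
  have h := weilSemilocalThreshold_uptoFiftyThree_le
  have hl := logSixtyOneLo_le
  rw [logSixtyOneLo] at hl
  push_cast at h hl
  linarith

/-- `q = 61` (`a*(S_61) ≤ 267/128 < (log 65)/2`). [tree certificate `SemilocalNegCertUptoFiftyNine`; thresholds: Yoshida1992HermitianForms Prop. 6] -/
theorem semilocalClassLawAt_sixtyone : SemilocalClassLawAt 61 :=
  semilocalClassLawAt_of_eq (Q := 65) (by decide) (fun m h1 h2 ↦ by interval_cases m <;> decide) weilSemilocalThreshold_uptoFiftyNine_lt_log_sixtyfive_half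

/-- `q = 67` (`a*(S_67) ≤ 545/256 < (log 71)/2`). [tree certificate `SemilocalNegCertUptoSixtyOneFinal`; thresholds: Yoshida1992HermitianForms Prop. 6] -/
theorem semilocalClassLawAt_sixtyseven : SemilocalClassLawAt 67 :=
  semilocalClassLawAt_of_eq (Q := 71) (by decide) (fun m h1 h2 ↦ by interval_cases m <;> decide) weilSemilocalThreshold_uptoSixtyOne_lt_log_seventyone_half

/-- `q = 71` (`a*(S_71) ≤ 549/256 < (log 73)/2`, margin `7·10⁻⁴`: the tree enclosure `logSeventyThreeLo ≤ log 73`). [tree certificate `SemilocalNegCertUptoSixtySeven`; thresholds: Yoshida1992HermitianForms Prop. 6] -/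
theorem semilocalClassLawAt_seventyone : SemilocalClassLawAt 71 := by
  refine semilocalClassLawAt_of_lt (Q := 73) (fun m h1 h2 ↦ by interval_cases m; decide) ?_
  rw [show Nat.primesBelow 71 = {2, 3, 5, 7, 11, 13, 17, 19, 23, 29, 31, 37, 41, 43, 47, 53, 59, 61, 67} from by decide]
  have h := weilSemilocalThreshold_uptoSixtySeven_le
  have hl := logSeventyThreeLo_le
  rw [logSeventyThreeLo] at hl
  push_cast at h hl
  linarith

/-- `q = 73` (`a*(S_73) ≤ 139/64 < (log 78)/2`). [tree certificate `SemilocalNegCertUptoSeventyOne`; thresholds: Yoshida1992HermitianForms Prop. 6] -/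
theorem semilocalClassLawAt_seventythree : SemilocalClassLawAt 73 :=
  semilocalClassLawAt_of_eq (Q := 78) (by decide) (fun m h1 h2 ↦ by interval_cases m <;> decide) weilSemilocalThreshold_uptoSeventyOne_lt_log_seventyeight_half

/-- `q = 79` (`a*(S_79) ≤ 1129/512 < (log 83)/2`). [tree certificate `SemilocalNegCertUptoSeventyThree`; thresholds: Yoshida1992HermitianForms Prop. 6] -/
theorem semilocalClassLawAt_seventynine : SemilocalClassLawAt 79 :=
  semilocalClassLawAt_of_eq (Q := 83) (by decide) (fun m h1 h2 ↦ by interval_cases m <;> decide) weilSemilocalThreshold_uptoSeventyThree_lt_log_eightythree_half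

/-- **C-I(a) HOLDS AT EVERY PRIME `q ≤ 79`** (22 walls; RH-free, kernel). [this cell, HOME/STRUCTURE.md §2 C-I(a); tree certificates `SemilocalNegCert*`] -/
theorem semilocalClassLawBelow_eighty : SemilocalClassLawBelow 80 := by
  intro q hq hlt
  have hmem : q ∈ Nat.primesBelow 80 := Nat.mem_primesBelow.2 ⟨hlt, hq⟩
  rw [show Nat.primesBelow 80 = {2, 3, 5, 7, 11, 13, 17, 19, 23, 29, 31, 37, 41, 43, 47, 53, 59, 61, 67, 71, 73, 79} from by decide] at hmem
  simp only [Finset.mem_insert, Finset.mem_singleton] at hmem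
  obtain rfl | rfl | rfl | rfl | rfl | rfl | rfl | rfl | rfl | rfl | rfl | rfl | rfl | rfl | rfl | rfl | rfl | rfl | rfl | rfl |
    rfl | rfl := hmem
  exacts [semilocalClassLawAt_two, semilocalClassLawAt_three, semilocalClassLawAt_five, semilocalClassLawAt_seven,
    semilocalClassLawAt_eleven, semilocalClassLawAt_thirteen, semilocalClassLawAt_seventeen, semilocalClassLawAt_nineteen,
    semilocalClassLawAt_twentythree, semilocalClassLawAt_twentynine, semilocalClassLawAt_thirtyone, semilocalClassLawAt_thirtyseven,
    semilocalClassLawAt_fortyone, semilocalClassLawAt_fortythree, semilocalClassLawAt_fortyseven, semilocalClassLawAt_fiftythree,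
    semilocalClassLawAt_fiftynine, semilocalClassLawAt_sixtyone, semilocalClassLawAt_sixtyseven, semilocalClassLawAt_seventyone,
    semilocalClassLawAt_seventythree, semilocalClassLawAt_seventynine]

/-! ## §4  The class law for EVERY finite `S` whose least missing prime is `≤ 79` -/

/-- **CLASS LAW, upper half, ∀ finite `S` with `q(S) ≤ 79` (RH-free)**: `a*(S) = a*(S_{q(S)})`. [this cell, HOME/STRUCTURE.md §2 C-I(a)] -/
theorem weilSemilocalThreshold_eq_primesBelow (h : leastMissingPrime S ≤ 79) :
    weilSemilocalThreshold S = weilSemilocalThreshold (Nat.primesBelow (leastMissingPrime S)) :=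
  weilSemilocalThreshold_eq_of_classLawAt (semilocalClassLawBelow_eighty _ (leastMissingPrime_prime S) (by omega))

/-- **… and `a*(S) < (log q(S)⁺)/2`**: every such form dies inside the window of its least missing prime. [this cell, HOME/STRUCTURE.md §2 C-I(a)] -/
theorem weilSemilocalThreshold_lt_log_nextPrime_half (h : leastMissingPrime S ≤ 79) :
    weilSemilocalThreshold S < Real.log (nextPrime (leastMissingPrime S)) / 2 :=
  weilSemilocalThreshold_lt_of_classLawAt (semilocalClassLawBelow_eighty _ (leastMissingPrime_prime S) (by omega))

/-- **RH-free LOWER half for `q(S) ≤ 7`**: `(log q(S))/2 ≤ a*(S)` — below `(log 7)/2 ≤ 1` the truncated form IS Weil's form, non-negative by the `a = 1` rung. [cite: Yoshida1992HermitianForms, Prop. 6 (p. 320); tree rung `WeilFormatCData.A1.weilPositivityOn_one`] -/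
theorem log_half_le_weilSemilocalThreshold_of_le_seven (h : leastMissingPrime S ≤ 7) :
    Real.log (leastMissingPrime S) / 2 ≤ weilSemilocalThreshold S := by
  have h1 := (leastMissingPrime_prime S).one_lt.le
  have h7 : Real.log (leastMissingPrime S) / 2 ≤ Real.log 7 / 2 := by
    have : (leastMissingPrime S : ℝ) ≤ 7 := by exact_mod_cast h
    linarith [Real.log_le_log (by exact_mod_cast (leastMissingPrime_prime S).pos) this]
  refine le_weilSemilocalThreshold ?_
  have hS : ∀ n ≤ leastMissingPrime S - 1, IsPrimePow n → n.primeFactors ⊆ S := fun n hn _ p hp ↦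
    mem_of_prime_lt_leastMissingPrime (Nat.prime_of_mem_primeFactors hp) (by have := Nat.le_of_mem_primeFactors hp; omega)
  have ha : Real.log (leastMissingPrime S) / 2 ≤ Real.log (((leastMissingPrime S - 1 : ℕ) : ℝ) + 1) / 2 := by
    rw [show ((leastMissingPrime S - 1 : ℕ) : ℝ) + 1 = leastMissingPrime S by exact_mod_cast Nat.sub_add_cancel h1]
  exact (weilSemilocalPositivityOn_iff_weilPositivityOn_of_le hS ha).2
    (HandoffLadderRungOne.weilPositivityOn_log_seven_half.mono h7)

/-- **THE TWO-SIDED CLASS LAW for `q(S) ≤ 7`, unconditionally**: `(log q)/2 ≤ a*(S) < (log q⁺)/2`, `q = q(S)`. [this cell, HOME/STRUCTURE.md §2 C-I(a)] -/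
theorem weilSemilocalThreshold_mem_Ico_of_le_seven (h : leastMissingPrime S ≤ 7) :
    weilSemilocalThreshold S ∈ Ico (Real.log (leastMissingPrime S) / 2) (Real.log (nextPrime (leastMissingPrime S)) / 2) :=
  ⟨log_half_le_weilSemilocalThreshold_of_le_seven h, weilSemilocalThreshold_lt_log_nextPrime_half (by omega)⟩

/-- **RH-free floor for `11 ≤ q(S) ≤ 79`**: `1 ≤ a*(S) < (log q(S)⁺)/2` (the `a = 1` rung through the class equality). [cite: Yoshida1992HermitianForms, Prop. 6 (p. 320); tree rung] -/
theorem one_le_weilSemilocalThreshold_of_ge_eleven (h11 : 11 ≤ leastMissingPrime S) (h : leastMissingPrime S ≤ 79) :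
    (1 : ℝ) ≤ weilSemilocalThreshold S := by
  rw [weilSemilocalThreshold_eq_primesBelow h]
  exact HandoffLadderRungOne.one_le_wall_of_ge_eight (by omega)

/-- **THE TWO-SIDED CLASS LAW under RH, for every finite `S` with `q(S) ≤ 79`**: `(log q)/2 ≤ a*(S) < (log q⁺)/2`. [cite: Bombieri2000Weil, §4 (Weil criterion); this cell, HOME/STRUCTURE.md §2 C-I(a)] -/
theorem weilSemilocalThreshold_mem_Ico_of_riemannHypothesis (hRH : Summit.RiemannHypothesis) (h : leastMissingPrime S ≤ 79) :
    weilSemilocalThreshold S ∈ Ico (Real.log (leastMissingPrime S) / 2) (Real.log (nextPrime (leastMissingPrime S)) / 2) :=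
  ⟨log_half_le_weilSemilocalThreshold_of_riemannHypothesis hRH S, weilSemilocalThreshold_lt_log_nextPrime_half h⟩

/-- The windows `[(log p)/2, (log p⁺)/2)` of distinct primes are disjoint, so a two-sided class law PINS the class. [folklore] -/
theorem prime_eq_of_mem_Ico {p p' : ℕ} (hp : p.Prime) (hp' : p'.Prime) {a : ℝ}
    (ha : a ∈ Ico (Real.log p / 2) (Real.log (nextPrime p) / 2)) (ha' : a ∈ Ico (Real.log p' / 2) (Real.log (nextPrime p') / 2)) :
    p = p' := by
  by_contra hne
  wlog hlt : p < p' generalizing p p'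
  · exact this hp' hp ha' ha (Ne.symm hne) (lt_of_le_of_ne (not_lt.1 hlt) (Ne.symm hne))
  have h1 : (nextPrime p : ℝ) ≤ p' := by exact_mod_cast nextPrime_le hp' hlt
  have h2 := Real.log_le_log (by exact_mod_cast (nextPrime_prime p).pos) h1
  linarith [ha.2, ha'.1]

/-- **«THE CLASS OF `S` IS EXACTLY ITS LEAST MISSING PRIME»** (`q(S) ≤ 7`, unconditionally): the unique prime `p` with `(log p)/2 ≤ a*(S) < (log p⁺)/2` is `q(S)`. [this cell, HOME/STRUCTURE.md §2 C-I(a)] -/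
theorem mem_Ico_iff_eq_leastMissingPrime_of_le_seven (h : leastMissingPrime S ≤ 7) {p : ℕ} (hp : p.Prime) :
    weilSemilocalThreshold S ∈ Ico (Real.log p / 2) (Real.log (nextPrime p) / 2) ↔ p = leastMissingPrime S :=
  ⟨fun hm ↦ prime_eq_of_mem_Ico hp (leastMissingPrime_prime S) hm (weilSemilocalThreshold_mem_Ico_of_le_seven h),
    fun he ↦ he ▸ weilSemilocalThreshold_mem_Ico_of_le_seven h⟩

/-- The same under RH for every finite `S` with `q(S) ≤ 79`. [this cell, HOME/STRUCTURE.md §2 C-I(a); Weil criterion: Bombieri2000Weil §4] -/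
theorem mem_Ico_iff_eq_leastMissingPrime_of_riemannHypothesis (hRH : Summit.RiemannHypothesis) (h : leastMissingPrime S ≤ 79)
    {p : ℕ} (hp : p.Prime) :
    weilSemilocalThreshold S ∈ Ico (Real.log p / 2) (Real.log (nextPrime p) / 2) ↔ p = leastMissingPrime S :=
  ⟨fun hm ↦ prime_eq_of_mem_Ico hp (leastMissingPrime_prime S) hm (weilSemilocalThreshold_mem_Ico_of_riemannHypothesis hRH h),
    fun he ↦ he ▸ weilSemilocalThreshold_mem_Ico_of_riemannHypothesis hRH h⟩

/-! ## §5  The tail -/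

/-- **C-I(a) ⟺ its tail beyond the certified walls**: `SemilocalClassLawFrom 0 ↔ SemilocalClassLawFrom 80`. [this cell, HOME/STRUCTURE.md §2 C-I(a)] -/
theorem semilocalClassLawFrom_zero_iff_from_eighty : SemilocalClassLawFrom 0 ↔ SemilocalClassLawFrom 80 :=
  ⟨fun h q hq _ ↦ h q hq (Nat.zero_le _), fun h q hq _ ↦ (Nat.lt_or_ge q 80).elim (semilocalClassLawBelow_eighty q hq) (h q hq)⟩

/-- **The tail from an exponent-`3/2` wall ceiling** (prove-2's RH-free target (P1), as a hypothesis): `δ*(q) ≤ C·(log q)^{3/2}·q^{−3/2}` for all primes `q ≥ q₀` ⇒ C-I(a) from an explicit `q₁` on. [this cell (HANDOFF track, ATTEMPT-15 §6)] -/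
theorem semilocalClassLawFrom_of_wallCeiling {C : ℝ} {q₀ : ℕ}
    (h : ∀ q : ℕ, q.Prime → q₀ ≤ q → wallOffset q ≤ C * Real.log q ^ (3 / 2 : ℝ) * (q : ℝ) ^ (-(3 / 2 : ℝ))) :
    ∃ q₁ : ℕ, SemilocalClassLawFrom q₁ := by
  obtain ⟨q₁, hq₁⟩ := upperClause_eventually_of_dodgerWallCeiling h
  exact ⟨q₁, fun q hq hle ↦ semilocalClassLawAt_iff_upperClause.2 (hq₁ q hle hq)⟩

/-- Under C-I(a) at `q` the wall MOVES at `q` as soon as the increment `H(q)` holds: `a*(S_q) < a*(S_{q⁺})` (theory-1's XII). [this cell (HANDOFF track)] -/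
theorem wall_lt_wall_nextPrime (hq : q.Prime) (h : SemilocalClassLawAt q) (hH : HandoffH q) :
    weilSemilocalThreshold (Nat.primesBelow q) < weilSemilocalThreshold (Nat.primesBelow (nextPrime q)) :=
  wall_lt_wall_nextPrime_of_upperClause hq (semilocalClassLawAt_iff_upperClause.1 h) hH

/-- The pen's packaging «`SemilocalClassLawBelow 83`» (≡ `Below 80`: no primes in `80…82`; cc-s2-3 g20 I l.7095). [this cell, HOME/STRUCTURE.md §2 C-I(a)] -/
theorem semilocalClassLawBelow_eightythree : SemilocalClassLawBelow 83 := fun q hq h ↦ semilocalClassLawBelow_eighty q hq (by by_contra h'; interval_cases q <;> exact absurd hq (by decide))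
/-- Monotonicity of the segment packaging in its ceiling. [folklore] -/
theorem SemilocalClassLawBelow.mono {Q' : ℕ} (hQ : SemilocalClassLawBelow Q') (hle : Q ≤ Q') : SemilocalClassLawBelow Q := fun q hq hlt ↦ hQ q hq (lt_of_lt_of_le hlt hle)
end Summit.RiemannHypothesis.RiemannHypothesis.Theorems.SemilocalClassLaw
end
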